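import Literature.NumberTheory.Multiplicative.Balazard1990.Compute
import HarnessLib

/-!
# Balazard (1990), Question 2 for `σ` — kernel evaluation of the breakpoint table `w(m) = m·2^(8−Ω(m))`

Source: M. Balazard, *Quelques exemples de suites unimodales en théorie des nombres*, Séminaire de Théorie des
Nombres de Bordeaux (2) **2** (1990) 13–30, doi:10.5802/jtnb.17 (open access) [Balazard1990], p. 27 Question 2
(with p. 14: log-concavity, p. 20: `σ(x,k)`).  PRIMARY READ from the vendored page-image excerpt of the H21 archive
(`archive/2001-boxes/tp/literature/sources/balazard-1990-jtnb2-unimodales/EXCERPTS-prove-tp-omega-count-log-concavity.md`,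
§BZ9 = p. 27, §BZ5 = p. 14, §BZ6 = p. 20).

Four KERNEL evaluations (`decide +kernel`, standard axioms; 1024 trial-division factorisations each): over the odd
`m = 2t+1` in the four windows `t ∈ [0,1024)`, `[1024,2048)`, `[2048,3072)`, `[3072,4096)` the values `w(m) < 2^13`
are the lists `wTab1, …, wTab4` of `Literature.NumberTheory.Multiplicative.Balazard1990.Compute` (`wTable_chunks`: together the 84-entry `wTable`, the 2001
programme's Table 1).  Meaning: `wTable_eq`, `Ncount_eq_NW` in `Literature.NumberTheory.Multiplicative.Balazard1990.TopRange`.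

Provenance: refutations bundle `papers/_cross/refutations` (H21 seat pub-refute-2, 2026-08-18), package module
`Refutations.Balazard1990.KernelTab1..4 (merged)`, moved into the tree under the Lean-in-tree rule (human 2026-08-18).  The
classification `E` and the proof structure are the 2001 H21 programme's (archive route `tp/omega-count-log-concavity`,
Theorem 1, "review: upheld"); the bundle's exact Python certificate `numerics/balazard1990/check_balazard_sigma_Q2.py`
checks the same two legs independently.
-/

namespace Literature.NumberTheory.Multiplicative.Balazard1990

/-- Kernel certificate of chunk 1 of the breakpoint table (odd `m`, `0 < m < 2048`). [folklore] -/
theorem wScan_chunk1 : wScan 0 1024 = wTab1 := by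
  decide +kernel

/-- Kernel certificate of chunk 2 of the breakpoint table (odd `m`, `2048 < m < 4096`). [folklore] -/
theorem wScan_chunk2 : wScan 1024 1024 = wTab2 := by
  decide +kernel

/-- Kernel certificate of chunk 3 of the breakpoint table (odd `m`, `4096 < m < 6144`). [folklore] -/
theorem wScan_chunk3 : wScan 2048 1024 = wTab3 := by
  decide +kernel

/-- Kernel certificate of chunk 4 of the breakpoint table (odd `m`, `6144 < m < 8192`). [folklore] -/
theorem wScan_chunk4 : wScan 3072 1024 = wTab4 := by
  decide +kernel

end Literature.NumberTheory.Multiplicative.Balazard1990
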